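import Mathlib.CategoryTheory.Galois.Prorepresentability
import Mathlib.CategoryTheory.Galois.Topology
import Mathlib.CategoryTheory.CofilteredSystem
import Mathlib.CategoryTheory.Conj
import Literature.AnabelianGeometry.Anabelioids.Basic
import HarnessLib

/-!
# Anabelioids: independence of the basepoint ([GeoAn] §1.1; [SGA1] V 5.7)

Mochizuki, *The geometry of anabelioids*, Publ. RIMS **40** (2004), §1.1, author's manuscript
pp. 9–10 [cite: MochizukiGeoAn2004, §1.1 pp.9-10]: a connected anabelioid `X` is a Galois
category; a *basepoint* of `X` is a fibre functor `β : X → FinSet`, and "the fundamental group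
`π₁(X, β) := Aut(β)` … is independent, up to inner automorphism, of the choice of basepoint"
— Grothendieck's theorem [SGA1] Exp. V, Cor. 5.7: any two fibre functors of a Galois category are
isomorphic [cite: SGA1, Exp. V Cor. 5.7].

Mathlib (`Mathlib.CategoryTheory.Galois.*`) has Galois categories, fibre functors, the
pro-representability of a fibre functor by the pointed Galois objects, and the fact that every
endomorphism of a fibre functor is an automorphism, but NOT the comparison of two fibre functors.
This file proves it (proof-only, no definitions):

* `nonempty_hom_of_fiberFunctor` — for fibre functors `F, G` there is a morphism `F ⟶ G`: by
  pro-representability of `F` (Mathlib's `PointedGaloisObject.isColimit`) a morphism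
  `F ⟶ G` is the same as a compatible system of points `s_A ∈ G(A)` over the (cofiltered)
  category of `F`-pointed Galois objects `(A, a)`, and such a system exists because a cofiltered
  system of nonempty finite sets has a section (`nonempty_sections_of_finite_cofiltered_system`);
* `isIso_of_fiberFunctor` — every morphism between fibre functors is an isomorphism (compose
  with a morphism the other way and use that endomorphisms of fibre functors are invertible);
* `nonempty_iso_of_fiberFunctor` — [SGA1] V 5.7: any two fibre functors are isomorphic;
* `nonempty_continuousMulEquiv_aut_of_fiberFunctor` — hence `π₁(X, β) ≃ π₁(X, β')` as
  topological groups (conjugation by an isomorphism of fibre functors is a homeomorphism for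
  Mathlib's profinite topologies on `Aut F`);
* `isSlim_iff_isSlimGroup_aut` — consequently slimness of a connected anabelioid ([GeoAn]
  Def. 1.2.4 (ii), the tree's `IsSlim`, which quantifies over every basepoint) can be checked at
  any single basepoint.
-/

namespace Literature.AnabelianGeometry.Anabelioids

open CategoryTheory CategoryTheory.Limits CategoryTheory.Functor CategoryTheory.PreGaloisCategory
open CategoryTheory.PreGaloisCategory.PointedGaloisObject
open Literature.AlgebraicGeometry.Frobenioids (IsSlimGroup)

universe u₁ u₂

variable {C : Type u₁} [Category.{u₂} C] [GaloisCategory C]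

/-- For fibre functors `F, G` of a Galois category there is a morphism `F ⟶ G`: a compatible
system of points of `G` on the `F`-pointed Galois objects (which exists, the system being a
cofiltered system of nonempty finite sets) induces one through the pro-representability of `F`.
[cite: SGA1, Exp. V Cor. 5.7] -/
theorem nonempty_hom_of_fiberFunctor (F G : C ⥤ FintypeCat.{u₂}) [FiberFunctor F]
    [FiberFunctor G] : Nonempty (F ⟶ G) := by
  classical
  -- the fibres of `G` on the `F`-pointed Galois objects: a cofiltered system of nonempty finite
  -- sets
  let D : PointedGaloisObject F ⥤ Type u₂ := incl F ⋙ G ⋙ FintypeCat.incl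
  haveI : ∀ A : PointedGaloisObject F, Finite (D.obj A) := fun A =>
    inferInstanceAs (Finite (G.obj A.obj))
  haveI : ∀ A : PointedGaloisObject F, Nonempty (D.obj A) := fun A =>
    inferInstanceAs (Nonempty (G.obj A.obj))
  obtain ⟨s, hs⟩ := nonempty_sections_of_finite_cofiltered_system D
  have hs' : ∀ {A B : PointedGaloisObject F} (h : A ⟶ B), G.map h.val (s A) = s B :=
    fun h => hs h
  -- the cocone over the pro-representing system of `F` with vertex `G`
  let c : Cocone ((incl F).op ⋙ coyoneda) :=
    { pt := G ⋙ FintypeCat.incl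
      ι :=
        { app := fun A =>
            { app := fun X => TypeCat.ofHom fun f : (A.unop.obj ⟶ X) => G.map f (s A.unop)
              naturality := fun X Y g => by
                ext f
                change G.map (f ≫ g) (s A.unop) = G.map g (G.map f (s A.unop))
                rw [G.map_comp, FintypeCat.comp_apply] }
          naturality := fun A B h => by
            ext X f
            change G.map (h.unop.val ≫ f) (s B.unop) = G.map f (s A.unop)
            rw [← hs' h.unop, G.map_comp, FintypeCat.comp_apply]
            rfl } }
  exact ⟨((FullyFaithful.ofFullyFaithful FintypeCat.incl).whiskeringRight C).preimage
    ((PointedGaloisObject.isColimit F).desc c)⟩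

/-- Every morphism between two fibre functors of a Galois category is an isomorphism.
[cite: SGA1, Exp. V Cor. 5.7] -/
theorem isIso_of_fiberFunctor {F G : C ⥤ FintypeCat.{u₂}} [FiberFunctor F] [FiberFunctor G]
    (η : F ⟶ G) : IsIso η := by
  obtain ⟨θ⟩ := nonempty_hom_of_fiberFunctor G F
  haveI : IsIso (η ≫ θ) := FibreFunctor.end_isIso F (η ≫ θ)
  haveI : IsIso (θ ≫ η) := FibreFunctor.end_isIso G (θ ≫ η)
  haveI : IsSplitMono η := IsSplitMono.mk'
    ⟨θ ≫ inv (η ≫ θ), by rw [← Category.assoc]; exact IsIso.hom_inv_id (η ≫ θ)⟩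
  haveI : IsSplitEpi η := IsSplitEpi.mk'
    ⟨inv (θ ≫ η) ≫ θ, by rw [Category.assoc]; exact IsIso.inv_hom_id (θ ≫ η)⟩
  exact isIso_of_mono_of_isSplitEpi η

/-- **[SGA1] V 5.7 / [GeoAn] §1.1**: any two fibre functors (basepoints) of a Galois category
(connected anabelioid) are isomorphic. [cite: SGA1, Exp. V Cor. 5.7] -/
theorem nonempty_iso_of_fiberFunctor (F G : C ⥤ FintypeCat.{u₂}) [FiberFunctor F]
    [FiberFunctor G] : Nonempty (F ≅ G) := by
  obtain ⟨η⟩ := nonempty_hom_of_fiberFunctor F G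
  haveI := isIso_of_fiberFunctor η
  exact ⟨asIso η⟩

/-- "The fundamental group `π₁(X, β) := Aut(β)` is independent, up to inner automorphism, of
the choice of basepoint" ([GeoAn] §1.1 p. 10): for fibre functors `F, G` there is an isomorphism of
topological groups `Aut F ≃ Aut G` (conjugation by an isomorphism `F ≅ G`; continuous because
Mathlib's topology on `Aut F` is the one induced from `∏_X Aut(F X)` and conjugation acts
coordinatewise; a continuous bijection from a compact to a Hausdorff group is a homeomorphism).
[cite: MochizukiGeoAn2004, §1.1 p.10] -/
theorem nonempty_continuousMulEquiv_aut_of_fiberFunctor (F G : C ⥤ FintypeCat.{u₂})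
    [FiberFunctor F] [FiberFunctor G] : Nonempty (Aut F ≃ₜ* Aut G) := by
  obtain ⟨e⟩ := nonempty_iso_of_fiberFunctor F G
  -- conjugation by `e` is continuous: it acts coordinatewise on `∏_X Aut (F X)`
  have hcont : Continuous e.conjAut := by
    rw [(autEmbedding_isClosedEmbedding G).isInducing.continuous_iff, continuous_pi_iff]
    intro X
    have hco : (fun σ : Aut F => autEmbedding G (e.conjAut σ) X) =
        fun σ => (e.app X).conjAut (autEmbedding F σ X) := by
      funext σ
      refine Iso.ext ?_
      simp [Iso.conj_apply, autEmbedding_apply]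
    rw [show (autEmbedding G ∘ e.conjAut) = fun σ => autEmbedding G (e.conjAut σ) from rfl]
    change Continuous fun σ : Aut F => autEmbedding G (e.conjAut σ) X
    rw [hco]
    exact continuous_of_discreteTopology.comp
      ((continuous_apply X).comp (autEmbedding_isClosedEmbedding F).continuous)
  exact ⟨{ e.conjAut with
    continuous_toFun := hcont
    continuous_invFun := Continuous.continuous_symm_of_equiv_compact_to_t2
      (f := e.conjAut.toEquiv) hcont }⟩

/-- Slimness of a topological group is invariant under isomorphisms of topological groups.
[folklore] -/
private theorem isSlimGroup_of_continuousMulEquiv {G₁ G₂ : Type*} [Group G₁]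
    [TopologicalSpace G₁] [Group G₂] [TopologicalSpace G₂] (e : G₁ ≃ₜ* G₂)
    (h : IsSlimGroup G₁) : IsSlimGroup G₂ := by
  refine ⟨fun H hH => ?_⟩
  have hH' : IsOpen ((H.comap e.toMonoidHom : Subgroup G₁) : Set G₁) := hH.preimage e.continuous
  have h1 := h.centralizer_eq_bot (H.comap e.toMonoidHom) hH'
  rw [eq_bot_iff] at h1 ⊢
  intro z hz
  have hz' :
      e.symm z ∈ Subgroup.centralizer ((H.comap e.toMonoidHom : Subgroup G₁) : Set G₁) := by
    rw [Subgroup.mem_centralizer_iff]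
    intro g hg
    apply e.injective
    have := Subgroup.mem_centralizer_iff.mp hz (e g) hg
    simpa using this
  have := h1 hz'
  rw [Subgroup.mem_bot] at this ⊢
  simpa using congrArg e this

/-- Slimness of a connected anabelioid ([GeoAn] Def. 1.2.4 (ii): `π₁(X, β)` slim — the tree's
`IsSlim X` asks it for EVERY basepoint `β`) may be checked at any single basepoint: for a fibre
functor `F`, `IsSlim X ↔ IsSlimGroup (Aut F)`. [cite: MochizukiGeoAn2004, Def. 1.2.4(ii) p.18] -/
theorem isSlim_iff_isSlimGroup_aut (F : C ⥤ FintypeCat.{u₂}) [FiberFunctor F] :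
    IsSlim C ↔ IsSlimGroup (Aut F) := by
  refine ⟨fun h => h.isSlimGroup F, fun h => ⟨fun G _ => ?_⟩⟩
  obtain ⟨e⟩ := nonempty_continuousMulEquiv_aut_of_fiberFunctor F G
  exact isSlimGroup_of_continuousMulEquiv e h

/-! ### One basepoint suffices: `π₁`-monomorphisms, `π₁`-epimorphisms, relative slimness

The tree's `IsPi1Mono`, `IsPi1Epi`, `IsRelativelySlim` ([GeoAn] Def. 1.1.7 (ii), Def. 1.2.9 (ii))
quantify over every basepoint of the source; by the independence of the basepoint they may be
checked at any single one. -/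

section OneBasepoint

universe v w

/-- Conjugation by an isomorphism `F ≅ G` of functors to finite sets is continuous on
automorphism groups (Mathlib's product topologies). [folklore] -/
private theorem continuous_conjAut {D : Type u₁} [Category.{u₂} D] {F G : D ⥤ FintypeCat.{w}}
    (e : F ≅ G) : Continuous e.conjAut := by
  rw [(autEmbedding_isClosedEmbedding G).isInducing.continuous_iff, continuous_pi_iff]
  intro X
  have hco : (fun σ : Aut F => autEmbedding G (e.conjAut σ) X) =
      fun σ => (e.app X).conjAut (autEmbedding F σ X) := by
    funext σ
    refine Iso.ext ?_
    simp [Iso.conj_apply, autEmbedding_apply]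
  change Continuous fun σ : Aut F => autEmbedding G (e.conjAut σ) X
  rw [hco]
  exact continuous_of_discreteTopology.comp
    ((continuous_apply X).comp (autEmbedding_isClosedEmbedding F).continuous)

variable {X : Type u₁} [Category.{u₂} X] {Y : Type v} [Category.{w} Y]

/-- The homomorphisms `π₁(φ)` at two basepoints `β, β'` of the source are conjugate: for an
isomorphism `e : β ≅ β'`, `π₁(φ)_{β'} ∘ (e-conjugation) = ((φ^* ⋆ e)-conjugation) ∘ π₁(φ)_β`.
[cite: MochizukiGeoAn2004, Def. 1.1.2(ii) p.10] -/
theorem pi1Map_conjAut (P : Y ⥤ X) {F F' : X ⥤ FintypeCat.{u₂}} (e : F ≅ F') (σ : Aut F) :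
    pi1Map P F' (e.conjAut σ) = (isoWhiskerLeft P e).conjAut (pi1Map P F σ) := by
  refine Iso.ext ?_
  ext B x
  simp [Iso.conjAut_hom, Iso.conj_apply, pi1Map_hom_app]
  rfl

variable [GaloisCategory X]

/-- `φ` is a `π₁`-monomorphism ([GeoAn] Def. 1.1.7 (ii), all basepoints) iff `π₁(φ)` is injective
at one basepoint. [cite: MochizukiGeoAn2004, Def. 1.1.7(ii) p.14] -/
theorem isPi1Mono_iff_injective (P : Y ⥤ X) (F : X ⥤ FintypeCat.{u₂}) [FiberFunctor F] :
    IsPi1Mono P ↔ Function.Injective (pi1Map P F) := by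
  refine ⟨fun h => h F, fun h F' _ => ?_⟩
  obtain ⟨e⟩ := nonempty_iso_of_fiberFunctor F F'
  intro σ τ hστ
  obtain ⟨σ₀, rfl⟩ := e.conjAut.surjective σ
  obtain ⟨τ₀, rfl⟩ := e.conjAut.surjective τ
  rw [pi1Map_conjAut, pi1Map_conjAut] at hστ
  rw [h ((isoWhiskerLeft P e).conjAut.injective hστ)]

/-- `φ` is a `π₁`-epimorphism ([GeoAn] Def. 1.1.7 (ii), all basepoints) iff `π₁(φ)` is
surjective at one basepoint. [cite: MochizukiGeoAn2004, Def. 1.1.7(ii) p.14] -/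
theorem isPi1Epi_iff_surjective (P : Y ⥤ X) (F : X ⥤ FintypeCat.{u₂}) [FiberFunctor F] :
    IsPi1Epi P ↔ Function.Surjective (pi1Map P F) := by
  refine ⟨fun h => h F, fun h F' _ => ?_⟩
  obtain ⟨e⟩ := nonempty_iso_of_fiberFunctor F F'
  intro τ
  obtain ⟨τ₀, rfl⟩ := (isoWhiskerLeft P e).conjAut.surjective τ
  obtain ⟨σ₀, rfl⟩ := h τ₀
  exact ⟨e.conjAut σ₀, pi1Map_conjAut P e σ₀⟩

/-- `φ` is relatively slim ([GeoAn] Def. 1.2.9 (ii), all basepoints) iff `π₁(φ)` is relatively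
slim at one basepoint. [cite: MochizukiGeoAn2004, Def. 1.2.9(ii) p.24] -/
theorem isRelativelySlim_iff_isRelativelySlimHom [GaloisCategory Y] (P : Y ⥤ X)
    (F : X ⥤ FintypeCat.{u₂}) [FiberFunctor F] :
    IsRelativelySlim P ↔ IsRelativelySlimHom (pi1Map P F) := by
  refine ⟨fun h => h F, fun h F' _ => ⟨fun U' hU' => ?_⟩⟩
  obtain ⟨e⟩ := nonempty_iso_of_fiberFunctor F F'
  -- pull `U'` back to the basepoint `F`
  let U : Subgroup (Aut F) := U'.comap e.conjAut.toMonoidHom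
  have hU : IsOpen (U : Set (Aut F)) := hU'.preimage (continuous_conjAut e)
  have hcen := h.centralizer_eq_bot U hU
  rw [eq_bot_iff] at hcen ⊢
  intro z hz
  -- `z` conjugated back centralizes `π₁(φ)_β(U)`
  have hz' : (isoWhiskerLeft P e).conjAut.symm z ∈
      Subgroup.centralizer (pi1Map P F '' (U : Set (Aut F))) := by
    rw [Subgroup.mem_centralizer_iff]
    rintro _ ⟨σ, hσ, rfl⟩
    apply (isoWhiskerLeft P e).conjAut.injective
    have hmem : pi1Map P F' (e.conjAut σ) ∈ pi1Map P F' '' (U' : Set (Aut F')) :=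
      ⟨e.conjAut σ, hσ, rfl⟩
    have := Subgroup.mem_centralizer_iff.mp hz _ hmem
    rw [pi1Map_conjAut] at this
    simpa using this
  have h1 := hcen hz'
  rw [Subgroup.mem_bot] at h1 ⊢
  simpa using congrArg (isoWhiskerLeft P e).conjAut h1

end OneBasepoint

end Literature.AnabelianGeometry.Anabelioids
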